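import Literature.AlgebraicGeometry.HodgeTheory.VHSDataHodgeLocusNowhereDense
import Literature.AlgebraicGeometry.HodgeTheory.VHSDataDeterminationLocusOverCurve
import HarnessLib

/-!
# Cattani–Deligne–Kaplan, Corollary 1.3 over a connected base of ANY dimension for the data `VHSData` of a polarized `ℤ`-variation: the set of
# points where some determination of a multivalued flat integral class is of type `(p, p)` is CLOSED and either the whole base or NOWHERE DENSE

Topic `Literature/AlgebraicGeometry/HodgeTheory` (namespace `Literature.AlgebraicGeometry.Motives.VHSData`), the several-variable companion of
`HodgeTheory/VHSDataDeterminationLocusOverCurve.lean` (Cor. 1.3 over a curve: everything or finite) over `HodgeTheory/VHSDataHodgeLocusNowhereDense.lean`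
(model lemmas in any dimension: `{h(c)v ∈ F}` is the chart or has empty interior; finite unions; relative closedness) and
`Topology/LocallyFullOrIsolatedSubset.lean` §5.  THEOREMS ONLY (no definition, no named fact, no instance; D-0026 net debt `0`).

PRINTED SOURCE, VERBATIM (E. Cattani, P. Deligne, A. Kaplan, *On the locus of Hodge classes*, J. Amer. Math. Soc. 8 (1995)).  p. 483: «locally on
`S`, the locus where a determination of `h_s` on the universal covering of `S` remains of type `(p, p)` is analytic»; p. 484: «**Corollary 1.3.**
Let `u` be a section of the local system `𝒱_ℤ` on a universal covering of `S`. The set of points in `S` where some determination of `u` is of type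
`(0, 0)` is an algebraic subvariety of `S`.  *Proof.* Such a set is a union of images of connected components of `S^{(K)}`, for `K = Q(u, u)`.»

`VHSData` READING (as in `VHSDataDeterminationLocusOverCurve`): the determinations of `u₀ ∈ V_ℤ,s₀` at `t` are the parallel transports `γ · u₀`,
`γ : s₀ ⇝ t`; the set of the corollary is `{t | ∃ γ, γ · u₀ is of type (p, p) at t}`.  FLAT INTERIOR CHARTS modelled on a complex normed space `E`
(`ψ : OpenPartialHomeomorph S E`; `e c : V_{ψ⁻¹(c)} ≃ V` carrying `F^p` to `h(c)⁻¹F₀^p` with `h` weakly holomorphic on the preconnected target, `V_ℤ`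
into a finitely generated `Λ`, comparison `κ‖1 ⊗ e_c x‖₀ ≤ ‖1 ⊗ x‖_{ψ⁻¹(c)}`, and any two points of the chart joined by a path class `δ` with
`e_{c′}(δ · y) = e_c(y)`).
* §1 `exists_finite_determinationLocus_param_chart_iff` — over a flat chart modelled on any type, the set is cut out by finitely many flat values:
  `ρ(c) ∈ {…} ⟺ ∃ v ∈ Υ′, h(c)(1 ⊗ v) ∈ F₀^p`.
* §2 `forall_mem_determinationLocus_or_interior_eq_empty_chart` — over a preconnected chart in `E`: everything, or empty interior;
  `eventually_not_mem_determinationLocus_chart` — relatively closed.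
* §3 through `ψ`: `exists_mem_nhds_subset_or_interior_eq_empty_determinationLocus`, `compl_determinationLocus_mem_nhds`.
* §4 **`determinationLocus_eq_univ_or_isNowhereDense`** — **COR. 1.3 (any dimension, analytic form): on a preconnected `S` covered by flat
  interior charts, `{t | ∃ γ : s₀ ⇝ t, γ · u₀ of type (p, p) at t}` is CLOSED and is ALL of `S` or NOWHERE DENSE** (no hypothesis at infinity is
  needed for this analytic statement; algebraicity is NOT asserted).

## References

* [CattaniDeligneKaplan1995] E. Cattani, P. Deligne, A. Kaplan, *On the locus of Hodge classes*, J. Amer. Math. Soc. 8 (1995) 483–506: §1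
  (pp. 483–484), Cor. 1.3.
* [VoisinHodgeII2003] C. Voisin, *Hodge Theory and Complex Algebraic Geometry II* (2003), §5.3.1 Lemma 5.13.
* [Schmid1973] W. Schmid, *Variation of Hodge structure: the singularities of the period mapping*, Invent. Math. 22 (1973), §2 (cite only).
* [FritzscheGrauert2002] K. Fritzsche, H. Grauert, *From Holomorphic Functions to Complex Manifolds*, GTM 213 (2002), Ch. I §8.
-/

noncomputable section

open scoped TensorProduct ComplexOrder
open _root_.Topology _root_.Filter Set

namespace Literature.AlgebraicGeometry

open Module
open Motives Motives.MixedHodgeStructure Motives.HodgeStructure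
open Motives.HodgeStructure (conj ofRat ofRat_apply conj_ofRat)
open HodgeTheory

universe u

namespace Motives.VHSData

variable {S : Type} [TopologicalSpace S] {k : ℤ} (D : VHSData S k)
variable {V : Type u} [AddCommGroup V] [Module ℚ V] [FiniteDimensional ℚ V]

/-! ## §1 Flat charts modelled on any type: finitely many flat values -/

/-- **Over a flat chart (any parameter type `X`), the set «some determination of `u₀` is of type `(p, p)`» is cut out by FINITELY many flat values**:
there is a finite `Υ′` with `(∃ γ : s₀ ⇝ ρ(c), γ·u₀ of type (p, p) at ρ(c)) ⟺ ∃ v ∈ Υ′, h(c)(1 ⊗ v) ∈ F₀^p` for `c ∈ U` («a union of images of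
connected components of `S^{(K)}`, for `K = Q(u, u)`»). [cite: CattaniDeligneKaplan1995, Cor. 1.3 and §1 (p. 484)] [cite: Schmid1973, §2 (cite only)] -/
theorem exists_finite_determinationLocus_param_chart_iff {X : Type*} {p : ℤ} (hpk : p + p = k) {s₀ : S} (u₀ : D.VZ.fiber s₀) (ρ : X → S)
    (U : Set X) (e : ∀ c : X, D.V.fiber (ρ c) ≃ₗ[ℚ] V) (H₀ : HodgeStructure V k) (P₀ : H₀.Polarization) (h : X → Module.End ℂ (ℂ ⊗[ℚ] V))
    (hF : ∀ c ∈ U, ((D.hodge (ρ c)).F p).map ((e c).toLinearMap.baseChange ℂ) = (H₀.F p).comap (h c))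
    (Λ : Submodule ℤ V) (hΛ : Λ.FG) (hΛ₁ : ∀ c ∈ U, ∀ u : D.VZ.fiber (ρ c), e c (D.toRat (ρ c) u) ∈ Λ)
    {κ : ℝ} (hκ : 0 < κ) (hnorm : ∀ c ∈ U, ∀ x : D.V.fiber (ρ c), κ * P₀.hodgeNorm (ofRat (e c x)) ≤ (D.form (ρ c)).hodgeNorm (ofRat x))
    (hflat : ∀ c ∈ U, ∀ c' ∈ U, ∃ δ : Path.Homotopic.Quotient (ρ c) (ρ c'), ∀ y : D.V.fiber (ρ c), e c' (D.V.transport δ y) = e c y) :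
    ∃ Υ' : Set V, Υ'.Finite ∧ ∀ c ∈ U,
      (∃ γ : Path.Homotopic.Quotient s₀ (ρ c), D.IsHodgeAt (ρ c) p (D.VZ.transport γ u₀)) ↔ ∃ v ∈ Υ', h c (ofRat v) ∈ H₀.F p := by
  set K : ℤ := ⌈(D.form s₀).form (D.toRat s₀ u₀) (D.toRat s₀ u₀)⌉ with hK
  have key : ∀ c ∈ U, ∀ u : D.VZ.fiber (ρ c), D.IsHodgeAt (ρ c) p u ↔ h c (ofRat (e c (D.toRat (ρ c) u))) ∈ H₀.F p :=
    fun c hc u => by rw [D.isHodgeAt_iff_ofRat_mem_of_map_F_eq (e c) (hF c hc) u, Submodule.mem_comap]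
  set Υ' : Set V := {v : V | ∃ c ∈ U, ∃ γ : Path.Homotopic.Quotient s₀ (ρ c), e c (D.toRat (ρ c) (D.VZ.transport γ u₀)) = v ∧
      D.IsHodgeAt (ρ c) p (D.VZ.transport γ u₀)} with hΥ'
  refine ⟨Υ', (D.finite_flatValues_isHodgeAt_param_chart hpk ρ U e H₀ P₀ Λ hΛ hΛ₁ hκ hnorm K).subset ?_, fun c hc => ?_⟩
  · rintro v ⟨c, hc, γ, rfl, hH⟩
    exact ⟨c, hc, _, rfl, hH, D.form_transport_le_ceil γ u₀⟩
  constructor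
  · rintro ⟨γ, hH⟩
    exact ⟨_, ⟨c, hc, γ, rfl, hH⟩, (key c hc _).1 hH⟩
  · rintro ⟨v, ⟨c₁, hc₁, γ, rfl, hH⟩, hmem⟩
    obtain ⟨δ, hδ⟩ := hflat c₁ hc₁ c hc
    refine ⟨γ.trans δ, (key c hc _).2 ?_⟩
    rwa [D.equiv_toRat_transport_trans (e c₁) (e c) δ hδ γ u₀]

/-! ## §2 Over a preconnected chart in `E`: everything or empty interior; relative closedness -/

variable {E : Type*} [NormedAddCommGroup E] [NormedSpace ℂ E]

/-- **Over a preconnected flat chart in `E`: EITHER every `ρ(c)` carries a determination of `u₀` of type `(p, p)`, OR the set of such `c ∈ U`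
has EMPTY INTERIOR** (finitely many loci `{h(c)v ∈ F₀^p}`, each the chart or of empty interior).
[cite: CattaniDeligneKaplan1995, §1 (pp. 483–484), Cor. 1.3] [cite: VoisinHodgeII2003, §5.3.1 Lemma 5.13] [cite: FritzscheGrauert2002, Ch. I §8] -/
theorem forall_mem_determinationLocus_or_interior_eq_empty_chart {p : ℤ} (hpk : p + p = k) {s₀ : S} (u₀ : D.VZ.fiber s₀) (ρ : E → S)
    {U : Set E} (hUc : IsPreconnected U) (e : ∀ c : E, D.V.fiber (ρ c) ≃ₗ[ℚ] V) (H₀ : HodgeStructure V k) (P₀ : H₀.Polarization)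
    (h : E → Module.End ℂ (ℂ ⊗[ℚ] V)) (hh : ∀ (φ : Module.Dual ℂ (ℂ ⊗[ℚ] V)) (w : ℂ ⊗[ℚ] V), AnalyticOnNhd ℂ (fun c => φ (h c w)) U)
    (hF : ∀ c ∈ U, ((D.hodge (ρ c)).F p).map ((e c).toLinearMap.baseChange ℂ) = (H₀.F p).comap (h c))
    (Λ : Submodule ℤ V) (hΛ : Λ.FG) (hΛ₁ : ∀ c ∈ U, ∀ u : D.VZ.fiber (ρ c), e c (D.toRat (ρ c) u) ∈ Λ)
    {κ : ℝ} (hκ : 0 < κ) (hnorm : ∀ c ∈ U, ∀ x : D.V.fiber (ρ c), κ * P₀.hodgeNorm (ofRat (e c x)) ≤ (D.form (ρ c)).hodgeNorm (ofRat x))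
    (hflat : ∀ c ∈ U, ∀ c' ∈ U, ∃ δ : Path.Homotopic.Quotient (ρ c) (ρ c'), ∀ y : D.V.fiber (ρ c), e c' (D.V.transport δ y) = e c y) :
    (∀ c ∈ U, ∃ γ : Path.Homotopic.Quotient s₀ (ρ c), D.IsHodgeAt (ρ c) p (D.VZ.transport γ u₀)) ∨
      interior {c : E | c ∈ U ∧ ∃ γ : Path.Homotopic.Quotient s₀ (ρ c), D.IsHodgeAt (ρ c) p (D.VZ.transport γ u₀)} = ∅ := by
  obtain ⟨Υ', hΥ', hiff⟩ := D.exists_finite_determinationLocus_param_chart_iff hpk u₀ ρ U e H₀ P₀ h hF Λ hΛ hΛ₁ hκ hnorm hflat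
  rcases exists_forall_mem_or_interior_eq_empty_of_finite hUc h hh (H₀.F p) (hΥ'.image ofRat) with ⟨w, ⟨v, hv, rfl⟩, hall⟩ | hint
  · exact Or.inl fun c hc => (hiff c hc).2 ⟨v, hv, hall c hc⟩
  · refine Or.inr (subset_empty_iff.1 (hint ▸ interior_mono ?_))
    rintro c ⟨hcU, hc⟩
    obtain ⟨v, hv, hvF⟩ := (hiff c hcU).1 hc
    exact ⟨hcU, ofRat v, ⟨v, hv, rfl⟩, hvF⟩

/-- **Relative closedness**: if no determination of `u₀` is of type `(p, p)` at `ρ(c₁)` (`c₁ ∈ U`), then the same holds at `ρ(c)` for `c ∈ U` near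
`c₁`. [cite: CattaniDeligneKaplan1995, §1 (p. 484), Cor. 1.3] -/
theorem eventually_not_mem_determinationLocus_chart {p : ℤ} (hpk : p + p = k) {s₀ : S} (u₀ : D.VZ.fiber s₀) (ρ : E → S) {U : Set E}
    (e : ∀ c : E, D.V.fiber (ρ c) ≃ₗ[ℚ] V) (H₀ : HodgeStructure V k) (P₀ : H₀.Polarization)
    (h : E → Module.End ℂ (ℂ ⊗[ℚ] V)) (hh : ∀ (φ : Module.Dual ℂ (ℂ ⊗[ℚ] V)) (w : ℂ ⊗[ℚ] V), AnalyticOnNhd ℂ (fun c => φ (h c w)) U)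
    (hF : ∀ c ∈ U, ((D.hodge (ρ c)).F p).map ((e c).toLinearMap.baseChange ℂ) = (H₀.F p).comap (h c))
    (Λ : Submodule ℤ V) (hΛ : Λ.FG) (hΛ₁ : ∀ c ∈ U, ∀ u : D.VZ.fiber (ρ c), e c (D.toRat (ρ c) u) ∈ Λ)
    {κ : ℝ} (hκ : 0 < κ) (hnorm : ∀ c ∈ U, ∀ x : D.V.fiber (ρ c), κ * P₀.hodgeNorm (ofRat (e c x)) ≤ (D.form (ρ c)).hodgeNorm (ofRat x))
    (hflat : ∀ c ∈ U, ∀ c' ∈ U, ∃ δ : Path.Homotopic.Quotient (ρ c) (ρ c'), ∀ y : D.V.fiber (ρ c), e c' (D.V.transport δ y) = e c y)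
    {c₁ : E} (hc₁ : c₁ ∈ U) (hnot : ¬ ∃ γ : Path.Homotopic.Quotient s₀ (ρ c₁), D.IsHodgeAt (ρ c₁) p (D.VZ.transport γ u₀)) :
    ∀ᶠ c in 𝓝 c₁, c ∈ U → ¬ ∃ γ : Path.Homotopic.Quotient s₀ (ρ c), D.IsHodgeAt (ρ c) p (D.VZ.transport γ u₀) := by
  obtain ⟨Υ', hΥ', hiff⟩ := D.exists_finite_determinationLocus_param_chart_iff hpk u₀ ρ U e H₀ P₀ h hF Λ hΛ hΛ₁ hκ hnorm hflat
  have hv : ∀ v ∈ Υ', h c₁ (ofRat v) ∉ H₀.F p := fun v hv hmem => hnot ((hiff c₁ hc₁).2 ⟨v, hv, hmem⟩)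
  have hev : ∀ᶠ c in 𝓝 c₁, ∀ v ∈ Υ', h c (ofRat v) ∉ H₀.F p :=
    hΥ'.eventually_all.2 fun v hv' => eventually_not_mem_of_not_mem h hh (H₀.F p) (ofRat v) hc₁ (hv v hv')
  filter_upwards [hev] with c hc hcU hmem
  obtain ⟨v, hv', hvF⟩ := (hiff c hcU).1 hmem
  exact hc v hv' hvF

/-! ## §3 Through a chart `ψ : OpenPartialHomeomorph S E` -/

/-- **At a point of a flat chart domain: a neighbourhood inside the set «some determination of `u₀` is of type `(p, p)`», or the set has empty
interior on the domain; and outside the set a whole neighbourhood is outside.**  Chart through `ψ : OpenPartialHomeomorph S E` with preconnected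
target, data as in `forall_mem_determinationLocus_or_interior_eq_empty_chart` for `ρ = ψ.symm`, `U = ψ.target`.
[cite: CattaniDeligneKaplan1995, §1 (pp. 483–484), Cor. 1.3] [cite: FritzscheGrauert2002, Ch. I §8] -/
theorem exists_mem_nhds_subset_or_interior_eq_empty_determinationLocus {p : ℤ} (hpk : p + p = k) {s₀ : S} (u₀ : D.VZ.fiber s₀)
    (ψ : OpenPartialHomeomorph S E) (hconn : IsPreconnected ψ.target) (e : ∀ c : E, D.V.fiber (ψ.symm c) ≃ₗ[ℚ] V)
    (H₀ : HodgeStructure V k) (P₀ : H₀.Polarization) (h : E → Module.End ℂ (ℂ ⊗[ℚ] V))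
    (hh : ∀ (φ : Module.Dual ℂ (ℂ ⊗[ℚ] V)) (w : ℂ ⊗[ℚ] V), AnalyticOnNhd ℂ (fun c => φ (h c w)) ψ.target)
    (hF : ∀ c ∈ ψ.target, ((D.hodge (ψ.symm c)).F p).map ((e c).toLinearMap.baseChange ℂ) = (H₀.F p).comap (h c))
    (Λ : Submodule ℤ V) (hΛ : Λ.FG) (hΛ₁ : ∀ c ∈ ψ.target, ∀ u : D.VZ.fiber (ψ.symm c), e c (D.toRat (ψ.symm c) u) ∈ Λ)
    {κ : ℝ} (hκ : 0 < κ)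
    (hnorm : ∀ c ∈ ψ.target, ∀ x : D.V.fiber (ψ.symm c), κ * P₀.hodgeNorm (ofRat (e c x)) ≤ (D.form (ψ.symm c)).hodgeNorm (ofRat x))
    (hflat : ∀ c ∈ ψ.target, ∀ c' ∈ ψ.target, ∃ δ : Path.Homotopic.Quotient (ψ.symm c) (ψ.symm c'),
      ∀ y : D.V.fiber (ψ.symm c), e c' (D.V.transport δ y) = e c y)
    {x : S} (hx : x ∈ ψ.source) :
    (∃ W ∈ 𝓝 x, W ⊆ {t : S | ∃ γ : Path.Homotopic.Quotient s₀ t, D.IsHodgeAt t p (D.VZ.transport γ u₀)} ∨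
        interior ({t : S | ∃ γ : Path.Homotopic.Quotient s₀ t, D.IsHodgeAt t p (D.VZ.transport γ u₀)} ∩ W) = ∅) ∧
      (x ∉ {t : S | ∃ γ : Path.Homotopic.Quotient s₀ t, D.IsHodgeAt t p (D.VZ.transport γ u₀)} →
        {t : S | ∃ γ : Path.Homotopic.Quotient s₀ t, D.IsHodgeAt t p (D.VZ.transport γ u₀)}ᶜ ∈ 𝓝 x) := by
  set Z : Set S := {t : S | ∃ γ : Path.Homotopic.Quotient s₀ t, D.IsHodgeAt t p (D.VZ.transport γ u₀)} with hZ
  refine ⟨⟨ψ.source, ψ.open_source.mem_nhds hx, ?_⟩, fun hnot => ?_⟩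
  · rcases D.forall_mem_determinationLocus_or_interior_eq_empty_chart hpk u₀ ψ.symm hconn e H₀ P₀ h hh hF Λ hΛ hΛ₁ hκ hnorm hflat with
      hall | hint
    · refine Or.inl fun y hy => ?_
      have h1 := hall (ψ y) (ψ.map_source hy)
      rw [ψ.left_inv hy] at h1
      exact h1
    · refine Or.inr (eq_empty_of_forall_notMem fun y hy => ?_)
      set O : Set S := interior (Z ∩ ψ.source) with hO
      have hOsrc : O ⊆ ψ.source := interior_subset.trans inter_subset_right
      have hOopen : IsOpen (ψ '' O) := (ψ.isOpen_image_iff_of_subset_source hOsrc).2 isOpen_interior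
      have hOsub : ψ '' O ⊆ {c : E | c ∈ ψ.target ∧
          ∃ γ : Path.Homotopic.Quotient s₀ (ψ.symm c), D.IsHodgeAt (ψ.symm c) p (D.VZ.transport γ u₀)} := by
        rintro _ ⟨z, hz, rfl⟩
        refine ⟨ψ.map_source (hOsrc hz), ?_⟩
        rw [ψ.left_inv (hOsrc hz)]
        exact (interior_subset hz).1
      have hmem := interior_maximal hOsub hOopen ⟨y, hy, rfl⟩
      rw [hint] at hmem
      exact hmem
  · have hc₀ : ψ x ∈ ψ.target := ψ.map_source hx
    have hnot' : ¬ ∃ γ : Path.Homotopic.Quotient s₀ (ψ.symm (ψ x)), D.IsHodgeAt (ψ.symm (ψ x)) p (D.VZ.transport γ u₀) := by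
      rw [ψ.left_inv hx]; exact hnot
    have hev := D.eventually_not_mem_determinationLocus_chart hpk u₀ ψ.symm e H₀ P₀ h hh hF Λ hΛ hΛ₁ hκ hnorm hflat hc₀ hnot'
    have h1 : ∀ᶠ y in 𝓝 x, y ∈ ψ.source := ψ.open_source.mem_nhds hx
    filter_upwards [h1, (ψ.continuousAt hx).eventually hev] with y hy hPy
    have h3 := hPy (ψ.map_source hy)
    rw [ψ.left_inv hy] at h3
    exact h3

/-! ## §4 Corollary 1.3 in any dimension (analytic form): everything or nowhere dense -/

/-- **Cattani–Deligne–Kaplan, COROLLARY 1.3 over a connected base of ANY dimension (analytic form) for `D : VHSData S k` (`k = p + p`).**  `S`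
preconnected; `u₀ ∈ V_ℤ,s₀`; at every point a FLAT interior chart modelled on a complex normed space `E` (`ψ : OpenPartialHomeomorph S E` with
preconnected target; `e c : V_{ψ⁻¹(c)} ≃ V` carrying `F^p` to `h(c)⁻¹F₀^p` with `h` weakly holomorphic, `V_ℤ` into a finitely generated `Λ₀`, a
comparison `κ‖1 ⊗ e_c x‖₀ ≤ ‖1 ⊗ x‖_{ψ⁻¹(c)}`, path classes inside the chart with `e_{c′}(δ·y) = e_c(y)`).  Then **the set of points `t` where SOME
determination `γ · u₀` (`γ : s₀ ⇝ t`) is of type `(p, p)` is CLOSED, and is ALL of `S` or NOWHERE DENSE** («locally on `S`, the locus where a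
determination of `h_s` … remains of type `(p, p)` is analytic»; a proper closed analytic subset of a connected base has empty interior).
[cite: CattaniDeligneKaplan1995, §1 (p. 483), Cor. 1.3 (p. 484)] [cite: VoisinHodgeII2003, §5.3.1 Lemma 5.13] [cite: FritzscheGrauert2002, Ch. I §8] -/
theorem determinationLocus_eq_univ_or_isNowhereDense [PreconnectedSpace S] {p : ℤ} (hpk : p + p = k) {s₀ : S} (u₀ : D.VZ.fiber s₀)
    (hint : ∀ x : S, ∃ ψ : OpenPartialHomeomorph S E, x ∈ ψ.source ∧ IsPreconnected ψ.target ∧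
      ∃ (e : ∀ c : E, D.V.fiber (ψ.symm c) ≃ₗ[ℚ] V) (H₀ : HodgeStructure V k) (P₀ : H₀.Polarization) (h : E → Module.End ℂ (ℂ ⊗[ℚ] V))
        (Λ₀ : Submodule ℤ V) (κ : ℝ),
        (∀ (φ : Module.Dual ℂ (ℂ ⊗[ℚ] V)) (w : ℂ ⊗[ℚ] V), AnalyticOnNhd ℂ (fun c => φ (h c w)) ψ.target) ∧
        (∀ c ∈ ψ.target, ((D.hodge (ψ.symm c)).F p).map ((e c).toLinearMap.baseChange ℂ) = (H₀.F p).comap (h c)) ∧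
        Λ₀.FG ∧ (∀ c ∈ ψ.target, ∀ u : D.VZ.fiber (ψ.symm c), e c (D.toRat (ψ.symm c) u) ∈ Λ₀) ∧
        0 < κ ∧ (∀ c ∈ ψ.target, ∀ x : D.V.fiber (ψ.symm c), κ * P₀.hodgeNorm (ofRat (e c x)) ≤ (D.form (ψ.symm c)).hodgeNorm (ofRat x)) ∧
        (∀ c ∈ ψ.target, ∀ c' ∈ ψ.target, ∃ δ : Path.Homotopic.Quotient (ψ.symm c) (ψ.symm c'),
          ∀ y : D.V.fiber (ψ.symm c), e c' (D.V.transport δ y) = e c y)) :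
    IsClosed {t : S | ∃ γ : Path.Homotopic.Quotient s₀ t, D.IsHodgeAt t p (D.VZ.transport γ u₀)} ∧
      ({t : S | ∃ γ : Path.Homotopic.Quotient s₀ t, D.IsHodgeAt t p (D.VZ.transport γ u₀)} = univ ∨
        IsNowhereDense {t : S | ∃ γ : Path.Homotopic.Quotient s₀ t, D.IsHodgeAt t p (D.VZ.transport γ u₀)}) := by
  set Z : Set S := {t : S | ∃ γ : Path.Homotopic.Quotient s₀ t, D.IsHodgeAt t p (D.VZ.transport γ u₀)} with hZ
  have hloc : ∀ x : S, (∃ W ∈ 𝓝 x, W ⊆ Z ∨ interior (Z ∩ W) = ∅) ∧ (x ∉ Z → Zᶜ ∈ 𝓝 x) := fun x => by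
    obtain ⟨ψ, hx, hconn, e, H₀, P₀, h, Λ₀, κ, hh, hF, hΛ₀, hΛ₁, hκ, hnorm, hflat⟩ := hint x
    exact D.exists_mem_nhds_subset_or_interior_eq_empty_determinationLocus hpk u₀ ψ hconn e H₀ P₀ h hh hF Λ₀ hΛ₀ hΛ₁ hκ hnorm hflat hx
  have hclosed : IsClosed Z := by
    rw [← isOpen_compl_iff, isOpen_iff_mem_nhds]
    exact fun x hx => (hloc x).2 hx
  exact ⟨hclosed, Literature.Topology.eq_univ_or_isNowhereDense hclosed fun x => (hloc x).1⟩

end Motives.VHSData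

end Literature.AlgebraicGeometry

end
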